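import Mathlib
import HarnessLib
import Summits.Parity.Statement
import Summits.Parity.GeneralizedHardyLittlewood.Theses.AbelianShadowSplit

/-!
# Assembly of route-Parity-AbelianShadowSplit (item stmt-Parity-28300)

`Assembly : ExcessGivenQ → APShiftDeficit → BoundedSiegelZeroQuality → UniformUpperGivenAP → UniformLowerGivenAP → FixedUpper → FixedLower → GeneralizedHardyLittlewood` is literally the route's certified deciding theorem `closes`
(node G1.2.1 «AbelianShadowSplit» (decomp-parity lens-2 g4; beneath the record's residual pair UU 26853 ∧ UL 26864)): the abelian-shadow pieces W⁺ (given Q) / W⁻, the two declared residuals and the fixed-system halves re-assemble UQ and LQ (`uqGlue`/`lqGlue`) and then GHL through the record's closes.  One line; no mathematics beyond the route file.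
-/

namespace Summit.Parity.GeneralizedHardyLittlewood.Theses.AbelianShadowSplit

/-- Assembly item stmt-Parity-28300 of route-Parity-AbelianShadowSplit:
`ExcessGivenQ → APShiftDeficit → BoundedSiegelZeroQuality → UniformUpperGivenAP → UniformLowerGivenAP → FixedUpper → FixedLower → GeneralizedHardyLittlewood`,
by the route's deciding theorem `closes`. -/
theorem assembly_proof : Assembly :=
  fun h1 h2 h3 h4 h5 h6 h7 => closes h1 h2 h3 h4 h5 h6 h7

end Summit.Parity.GeneralizedHardyLittlewood.Theses.AbelianShadowSplit
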